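import Literature.NumberTheory.Automorphic.AutomorphicLFunctionFlathProofs
import HarnessLib

/-!
# `summable_normSq_trace_satakePow`: reduction to finite exceptional sets

Trunk `AutomorphicAxiomatic` (G19), topic `NumberTheory/Automorphic`; namespace `Literature.Automorphic`.
Assembly file for the named fact `summable_normSq_trace_satakePow` of
`AutomorphicLFunctionProofs` (Jacquet–Shalika, *On Euler products and the classification of
automorphic representations I*, Amer. J. Math. **103** (1981), proof of Thm. (5.3),
(5.3.3)–(5.3.4): for a cuspidal automorphic representation `Π` of `GL_n(𝔸_K)` with Hecke–Satake
parameters `α v` off a set `S` of finite places, the series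
`∑_{v ∉ S} ∑_{k ≥ 1} |tr A_v^k|² / (k q_v^{kσ})` converges for every `σ > 1`).

The fact is stated for an *arbitrary* set `S` of finite places (possibly infinite, possibly
empty in the unramified case), whereas every proof — the printed one (Lemma (5.2), Landau's lemma
and Cor. (2.5) of the source, architecture recorded in `JacquetShalikaEulerProducts`) as well as the
direct Rankin–Selberg estimate — produces the statement for *finite* `S`. This file proves, once
and for all, that the finite case suffices (theorems only; no definition, no named fact):

* `summable_normSq_trace_satakePow_of_finset`: if (5.3.3) holds for every cuspidal `Π`, every
  *finite* `S` and every Satake family of `Π` off `S`, then `summable_normSq_trace_satakePow`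
  holds. Proof: the set `R` of ramified places of `Π` is finite (Flath, *discharged* in the tree:
  `exists_isSatakeFamilyOf_holds` of `AutomorphicLFunctionFlathProofs` provides a Satake family `β`
  of `Π` off a finite `R`); given `α` off an arbitrary `S`, the family `α'` equal to `α` off `S` and
  to `β` on `S` is a Satake family off the finite set `R ∩ S`, and the series for `(S, α)` is a
  sub-series (non-negative terms, in fact any terms: `Summable.comp_injective` in `ℝ`) of the
  series for `(R ∩ S, α')`.
* `summable_normSq_trace_satakePow_iff_finset`: the equivalence.

## References

* H. Jacquet, J. A. Shalika, *On Euler products and the classification of automorphic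
  representations I*, Amer. J. Math. 103 (1981), 499–558: Thm. (5.3), proof, (5.3.3)–(5.3.4)
  (p. 556) [JacquetShalikaAJM1981].
* D. Flath, *Decomposition of representations into tensor products*, Proc. Sympos. Pure Math. 33
  (Corvallis 1979), part 1, Thm. 3 [FlathCorvallis1979].
-/

noncomputable section

open NumberField IsDedekindDomain MeasureTheory

namespace Literature.NumberTheory.Automorphic

variable {n : ℕ} {K : Type} [Field K] [NumberField K]
  {μ : Measure (AdelicGroupData.gl n K).automorphicQuotient}
  [(AdelicGroupData.gl n K).IsAutomorphicMeasure μ]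

/-- **(5.3.3)–(5.3.4) for arbitrary exceptional sets from the case of finite ones.** Suppose that
for every cuspidal automorphic representation `Π` of `GL_n(𝔸_K)`, every *finite* set `S` of
finite places and every Satake family `α` of `Π` off `S`, the series
`∑_{v ∉ S} ∑_{k ≥ 1} |tr A_v^k|² / (k q_v^{kσ})` converges for all `σ > 1` (Jacquet–Shalika (1981),
(5.3.3)–(5.3.4), the printed generality: `S` finite). Then the named fact
`summable_normSq_trace_satakePow` (arbitrary `S`) holds: with `β` a Satake family of `Π` off the
finite set `R` of its ramified places (Flath; `exists_isSatakeFamilyOf_holds`), the family which is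
`α` off `S` and `β` on `S` is a Satake family off the finite set `R ∩ S ⊆ S`, and the series over
`v ∉ S` is a sub-series of the one over `v ∉ R ∩ S`. [folklore] -/
theorem summable_normSq_trace_satakePow_of_finset
    (h : ∀ (P : CuspidalAutomorphicRepGL n K μ) (S : Finset (HeightOneSpectrum (𝓞 K)))
      (α : SatakeFamily K), IsSatakeFamilyOf P ↑S α → ∀ σ : ℝ, 1 < σ →
        Summable fun kv : ℕ × {v : HeightOneSpectrum (𝓞 K) // v ∉ (↑S : Set _)} =>
          ‖((α kv.2.1).map (· ^ (kv.1 + 1))).sum‖ ^ 2 /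
            ((kv.1 + 1 : ℝ) * (kv.2.1.residueCard : ℝ) ^ ((kv.1 + 1 : ℝ) * σ))) :
    summable_normSq_trace_satakePow (μ := μ) := by
  classical
  intro P S α hα σ hσ
  obtain ⟨R, β, -, hβ⟩ := exists_isSatakeFamilyOf_holds (μ := μ) P
  -- the finite exceptional set `R ∩ S` and the merged family
  set S' : Finset (HeightOneSpectrum (𝓞 K)) := R.filter (· ∈ S) with hS'
  let α' : SatakeFamily K := fun v => if v ∈ S then β v else α v
  have hα'S : ∀ v ∉ S, α' v = α v := fun v hv => if_neg hv
  have hS'S : (↑S' : Set (HeightOneSpectrum (𝓞 K))) ⊆ S := by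
    intro v hv
    rw [hS', Finset.coe_filter] at hv
    exact hv.2
  have hα' : IsSatakeFamilyOf P ↑S' α' := by
    intro v hv
    by_cases hvS : v ∈ S
    · have hvR : v ∉ (↑R : Set (HeightOneSpectrum (𝓞 K))) := fun hvR =>
        hv (by rw [hS', Finset.coe_filter]; exact ⟨hvR, hvS⟩)
      simp only [α', if_pos hvS]
      exact hβ v hvR
    · simp only [α', if_neg hvS]
      exact hα v hvS
  have hsum := h P S' α' hα' σ hσ
  -- restrict along the injection `{v ∉ S} ↪ {v ∉ S'}`
  let ι : ℕ × {v : HeightOneSpectrum (𝓞 K) // v ∉ S} →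
      ℕ × {v : HeightOneSpectrum (𝓞 K) // v ∉ (↑S' : Set _)} :=
    fun kv => (kv.1, ⟨kv.2.1, fun h' => kv.2.2 (hS'S h')⟩)
  have hι : Function.Injective ι := by
    rintro ⟨k, v, hv⟩ ⟨k', v', hv'⟩ h'
    simp only [ι, Prod.mk.injEq, Subtype.mk.injEq] at h'
    obtain ⟨rfl, rfl⟩ := h'
    rfl
  refine (hsum.comp_injective hι).congr fun kv => ?_
  simp only [Function.comp_apply, ι, hα'S kv.2.1 kv.2.2]

/-- `summable_normSq_trace_satakePow` is equivalent to its case of finite exceptional sets `S`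
(the converse specialises `S` to `↑S`). [folklore] -/
theorem summable_normSq_trace_satakePow_iff_finset :
    summable_normSq_trace_satakePow (μ := μ) ↔
      ∀ (P : CuspidalAutomorphicRepGL n K μ) (S : Finset (HeightOneSpectrum (𝓞 K)))
        (α : SatakeFamily K), IsSatakeFamilyOf P ↑S α → ∀ σ : ℝ, 1 < σ →
          Summable fun kv : ℕ × {v : HeightOneSpectrum (𝓞 K) // v ∉ (↑S : Set _)} =>
            ‖((α kv.2.1).map (· ^ (kv.1 + 1))).sum‖ ^ 2 /
              ((kv.1 + 1 : ℝ) * (kv.2.1.residueCard : ℝ) ^ ((kv.1 + 1 : ℝ) * σ)) :=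
  ⟨fun h P _ _ hα _ hσ => h P hα hσ, summable_normSq_trace_satakePow_of_finset⟩

end Literature.NumberTheory.Automorphic
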